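import Mathlib
import Summits.NavierStokesRegularity.NavierStokesRegularity.Theorems.EulerZoomLiouvillePowerGaugeEulerLiouvilleSelfSimilarBernoulliSqueezeVorticalMember
import Summits.NavierStokesRegularity.NavierStokesRegularity.Theorems.EulerZoomLiouvillePowerGaugeEulerLiouvilleSelfSimilarBernoulliSqueezeSharpPast
import Summits.NavierStokesRegularity.NavierStokesRegularity.Theorems.EulerZoomLiouvillePowerGaugeEulerLiouvilleSelfSimilarBernoulliSqueezeSobolev
import Literature.Analysis.Calculus.SmoothCutoff
import HarnessLib

/-!
# «PRESSURE SPIKES COST ENSTROPHY» — tools: the pressure gradient of a class profile, scalar GNS on a cut-off copy, the prior (Chebyshev) thinness of the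
# pressurised set, and a `C¹` truncation with its gradient bound
# (crux `EulerZoomLiouville.PowerGaugeEulerLiouville` = stmt-NavierStokesRegularity-19832, line `birth`, THE ONE STATEMENT)

Route №10 `EulerZoomLiouville` (NavierStokesRegularity); LEAD ns-typeII-p2 g12.  First of two files; the sequel `…SqueezePressureThin` runs the bootstrap
(the pressurised set `{P′ ≳ ‖y‖²}` of a class profile is thin with the SOBOLEV rate `3+3ρ`, no pressure clause) and the member theorem (vortical (C2) squeeze
with threshold `1/((2+ρ)(1+ρ))`, no pressure clause).  Here:

* `norm_fderiv_pressure_le_of_profile` — the profile equation (CIV (3.3)) bounds `‖∇P′‖ ≤ (1−γ)‖V‖ + ‖∇V‖(γ‖y‖ + ‖V‖)`;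
* `lintegral_pow_six_le_of_cutoff_real` — scalar Gagliardo–Nirenberg–Sobolev on a cut-off copy (`p = 2`, `p* = 6`; the LEAD's g11 vector version applied to
  `y ↦ g(y)•e₀`);
* `volume_pressureHigh_inter_ball_le_prior` — PRIOR thinness `vol({κL² < P′} ∩ B_{5L}) ≤ C_P L^{−1−2ρ}` (`L ≥ L₁`) from the weighted `D`-datum
  `∫|P|^{3/2}‖y‖^{2ρ−2} ≤ C_D` of the member's pressure profile `P` and the bridge `P = P′ + c₀` a.e. (Chebyshev; `P′` is bounded on the unit ball);
* `exists_truncation` — a `C¹` truncation `g = A·S((P′−A)/A)` (`S` Mathlib's smooth transition): `0 ≤ g ≤ A`, `g = 0` on `{P′ ≤ A}`, `g = A` on `{2A ≤ P′}`,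
  `‖∇g‖ ≤ D‖∇P′‖`; `enorm_fderiv_truncation_sq_le` — with the profile equation and linear growth, `‖∇g‖² ≤ 2D²(1−γ)²|V|² + 2D²(γ+K₁)²(1+5L)²‖∇V‖²` on `B_{5L}`;
* `bootstrap_bookkeeping`, `bootstrap_exponent` — the real arithmetic of the bootstrap (`≲ L^{3−ρ}` terms; `Cr⁶(ZL^{3−ρ})³/(κL²)⁶ = (Cr⁶Z³/κ⁶)L^{−3−3ρ}`).

WHAT THIS IS NOT: not NS, not E — tools for a classical sub-stratum `--supports` stmt-19832 on the MODEL lattice; 19832 OPEN; NS regularity NOT proved.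
[folklore; ConstantinIgnatovaVicol2026Putative §3.2 (3.3); Gagliardo–Nirenberg–Sobolev inequality]
-/


noncomputable section

-- flat `Theorems/<Route><Decl>…` files of one crux share the namespace of the crux (tree convention)
set_option linter.dupNamespace false

open MeasureTheory Set Filter Topology Metric Function InnerProductSpace
open scoped RealInnerProductSpace NNReal ENNReal ContDiff

namespace Summit.NavierStokesRegularity.NavierStokesRegularity.Theorems.PowerGaugeEulerLiouville.Loc

open Literature.Analysis Literature.Analysis.FluidPDE Literature.Analysis.FunctionSpaces
open Summit.NavierStokesRegularity.NavierStokesRegularity.Theorems.PowerGaugeEulerLiouville.BernoulliThinness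

/-! ### The gradient of the classical pressure -/

/-- **The profile equation bounds the pressure gradient**: for a CIV profile `(V, P′)` with exponent `γ ∈ [0,1]` centred at `0`,
`‖∇P′(y)‖ ≤ (1−γ)‖V y‖ + ‖∇V(y)‖ (γ‖y‖ + ‖V y‖)` (from `∇P′ = −(1−γ)V − ((γy + V)·∇)V`, CIV (3.3)). [folklore; ConstantinIgnatovaVicol2026Putative §3.2 (3.3)] -/
theorem norm_fderiv_pressure_le_of_profile {γ : ℝ} (hγ0 : 0 ≤ γ) (hγ1 : γ ≤ 1)
    {V : EuclideanSpace ℝ (Fin 3) → EuclideanSpace ℝ (Fin 3)} {P' : EuclideanSpace ℝ (Fin 3) → ℝ}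
    (hprof : IsSelfSimilarEulerProfile γ 0 V P') (y : EuclideanSpace ℝ (Fin 3)) :
    ‖fderiv ℝ P' y‖ ≤ (1 - γ) * ‖V y‖ + ‖fderiv ℝ V y‖ * (γ * ‖y‖ + ‖V y‖) := by
  have h := hprof.profile_eq y
  simp only [sub_zero] at h
  have hg : gradient P' y = -((1 - γ) • V y + fderiv ℝ V y (γ • y + V y)) := eq_neg_of_add_eq_zero_right h
  have hn : ‖fderiv ℝ P' y‖ = ‖gradient P' y‖ := by
    rw [gradient, LinearIsometryEquiv.norm_map]
  rw [hn, hg, norm_neg]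
  calc ‖(1 - γ) • V y + fderiv ℝ V y (γ • y + V y)‖
      ≤ ‖(1 - γ) • V y‖ + ‖fderiv ℝ V y (γ • y + V y)‖ := norm_add_le _ _
    _ ≤ (1 - γ) * ‖V y‖ + ‖fderiv ℝ V y‖ * (γ * ‖y‖ + ‖V y‖) := by
        refine add_le_add ?_ ?_
        · rw [norm_smul, Real.norm_of_nonneg (by linarith)]
        · refine (ContinuousLinearMap.le_opNorm _ _).trans (mul_le_mul_of_nonneg_left ?_ (norm_nonneg _))
          calc ‖γ • y + V y‖ ≤ ‖γ • y‖ + ‖V y‖ := norm_add_le _ _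
            _ = γ * ‖y‖ + ‖V y‖ := by rw [norm_smul, Real.norm_of_nonneg hγ0]

/-! ### Gagliardo–Nirenberg–Sobolev for a cut-off scalar field -/

/-- **`L⁶` mass of a scalar `C¹` field on `‖y‖ ≤ 2L` from its gradient energy and mass on `B_{5L}`** — the scalar twin of
`Loc.lintegral_norm_pow_six_le_of_cutoff` (apply it to `y ↦ g(y) • e₀` for a unit vector `e₀`). [folklore; Gagliardo–Nirenberg–Sobolev inequality] -/
theorem lintegral_pow_six_le_of_cutoff_real {g : EuclideanSpace ℝ (Fin 3) → ℝ} (hg : ContDiff ℝ 1 g)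
    {χ : EuclideanSpace ℝ (Fin 3) → ℝ} (hχ1 : ContDiff ℝ 1 χ) (hχc : HasCompactSupport χ) (h1 : ∀ y, χ y ≤ 1) (h0 : ∀ y, 0 ≤ χ y)
    {L B : ℝ} (hL : 0 < L) (hone : ∀ y, ‖y‖ ≤ 2 * L → χ y = 1) (hzero : ∀ y, 4 * L < ‖y‖ → χ =ᶠ[𝓝 y] fun _ => 0)
    (hB : ∀ y, ‖fderiv ℝ χ y‖ ≤ B) :
    ∫⁻ y in closedBall (0 : EuclideanSpace ℝ (Fin 3)) (2 * L), ‖g y‖ₑ ^ 6 ≤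
      (eLpNormLESNormFDerivOfEqInnerConst (volume : Measure (EuclideanSpace ℝ (Fin 3))) 2 : ℝ≥0∞) ^ 6 *
        ((2 * ∫⁻ y in ball (0 : EuclideanSpace ℝ (Fin 3)) (5 * L), ‖fderiv ℝ g y‖ₑ ^ 2) +
          2 * ENNReal.ofReal (B ^ 2) * ∫⁻ y in ball (0 : EuclideanSpace ℝ (Fin 3)) (5 * L), ‖g y‖ₑ ^ 2) ^ 3 := by
  set e₀ : EuclideanSpace ℝ (Fin 3) := EuclideanSpace.single 0 1 with he₀
  have he₀n : ‖e₀‖ = 1 := by simp [he₀]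
  set W : EuclideanSpace ℝ (Fin 3) → EuclideanSpace ℝ (Fin 3) := fun y => g y • e₀ with hW
  have hW1 : ContDiff ℝ 1 W := hg.smul contDiff_const
  have hgd : Differentiable ℝ g := hg.differentiable one_ne_zero
  have hWn : ∀ y, ‖W y‖ₑ = ‖g y‖ₑ := by
    intro y
    rw [← ofReal_norm, ← ofReal_norm, hW]
    simp only [norm_smul, he₀n, mul_one]
  have hWd : ∀ y, ‖fderiv ℝ W y‖ₑ = ‖fderiv ℝ g y‖ₑ := by
    intro y
    rw [← ofReal_norm, ← ofReal_norm, hW, fderiv_smul_const (hgd y), ContinuousLinearMap.norm_smulRight_apply, he₀n, mul_one]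
  have h := lintegral_norm_pow_six_le_of_cutoff hW1 hχ1 hχc h1 h0 hL hone hzero hB
  simp_rw [hWn, hWd] at h
  exact h

/-! ### The prior bound: the pressurised set is thin with rate `1+2ρ` (the `D`-gauge) -/

/-- **Prior thinness of the pressurised set of the CLASSICAL pressure** (`ρ < 1`): if the member's pressure profile `P` carries the weighted `D`-datum
`∫ |P|^{3/2} ‖y‖^{2ρ−2} ≤ C_D` and `P = P′ + c₀` a.e. for a continuous `P′`, then for every `κ > 0` there are `C_P ≥ 0`, `L₁ ≥ 1` with
`vol({κL² < P′} ∩ B_{5L}) ≤ C_P L^{−1−2ρ}` for `L ≥ L₁` (Chebyshev; `P′` is bounded on the unit ball, so the set avoids it for `L` large). [folklore] -/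
theorem volume_pressureHigh_inter_ball_le_prior {ρ : ℝ} (hρ1 : ρ < 1)
    {P : EuclideanSpace ℝ (Fin 3) → ℝ} (hPm : AEStronglyMeasurable P volume) {CD : ℝ}
    (hD : ∫⁻ y, ‖P y‖ₑ ^ (3 / 2 : ℝ) * ENNReal.ofReal (‖y‖ ^ (2 * ρ - 2)) ≤ ENNReal.ofReal CD)
    {P' : EuclideanSpace ℝ (Fin 3) → ℝ} (hP'c : Continuous P') {c₀ : ℝ} (hc₀ : P =ᵐ[volume] fun y => P' y + c₀)
    {κ : ℝ} (hκ : 0 < κ) :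
    ∃ CP L₁ : ℝ, 0 ≤ CP ∧ 1 ≤ L₁ ∧ ∀ L : ℝ, L₁ ≤ L →
      volume ({y : EuclideanSpace ℝ (Fin 3) | κ * L ^ 2 < P' y} ∩ ball (0 : EuclideanSpace ℝ (Fin 3)) (5 * L)) ≤
        ENNReal.ofReal (CP * L ^ (-1 - 2 * ρ)) := by
  -- `P'` is bounded on the unit ball
  obtain ⟨M₀, hM₀⟩ := (isCompact_closedBall (0 : EuclideanSpace ℝ (Fin 3)) 1).exists_bound_of_continuousOn hP'c.continuousOn
  set CDp : ℝ := max CD 0 with hCDp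
  have hCDp0 : 0 ≤ CDp := le_max_right _ _
  have hD' : ∫⁻ y, ‖P y‖ₑ ^ (3 / 2 : ℝ) * ENNReal.ofReal (‖y‖ ^ (2 * ρ - 2)) ≤ ENNReal.ofReal CDp :=
    hD.trans (ENNReal.ofReal_le_ofReal (le_max_left _ _))
  set k : ℝ := (κ / 2) ^ (3 / 2 : ℝ) * (5 : ℝ) ^ (2 * ρ - 2) with hk
  have hk0 : 0 < k := by positivity
  set L₁ : ℝ := max 1 ((|M₀| + 2 * |c₀|) / κ) with hL₁
  refine ⟨CDp / k, L₁, by positivity, le_max_left _ _, fun L hL => ?_⟩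
  have hL1 : 1 ≤ L := (le_max_left _ _).trans hL
  have hL0 : 0 < L := one_pos.trans_le hL1
  have hκL : |M₀| + 2 * |c₀| ≤ κ * L ^ 2 := by
    have h1 : (|M₀| + 2 * |c₀|) / κ ≤ L := (le_max_right _ _).trans hL
    rw [div_le_iff₀ hκ] at h1
    have h2 : κ * L ≤ κ * L ^ 2 := by
      rw [sq]; exact mul_le_mul_of_nonneg_left (le_mul_of_one_le_left hL0.le hL1) hκ.le
    linarith
  set S : Set (EuclideanSpace ℝ (Fin 3)) := {y | κ * L ^ 2 < P' y} ∩ ball (0 : EuclideanSpace ℝ (Fin 3)) (5 * L) with hS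
  set S' : Set (EuclideanSpace ℝ (Fin 3)) := {y | 1 < ‖y‖ ∧ ‖y‖ < 5 * L ∧ κ * L ^ 2 / 2 < P y} with hS'
  have hsub : ∀ᵐ y ∂(volume : Measure (EuclideanSpace ℝ (Fin 3))), y ∈ S → y ∈ S' := by
    filter_upwards [hc₀] with y hy hyS
    obtain ⟨hyP, hyb⟩ := hyS
    rw [mem_setOf_eq] at hyP
    rw [mem_ball_zero_iff] at hyb
    refine ⟨?_, hyb, ?_⟩
    · by_contra hle
      push Not at hle
      have hb := hM₀ y (mem_closedBall_zero_iff.2 hle)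
      rw [Real.norm_eq_abs] at hb
      have h2 : P' y ≤ |M₀| := (le_abs_self _).trans (hb.trans (le_abs_self _))
      linarith [abs_nonneg c₀]
    · show κ * L ^ 2 / 2 < P y
      rw [hy]
      linarith [neg_abs_le c₀, abs_nonneg M₀]
  -- Chebyshev on `S'`
  set f : EuclideanSpace ℝ (Fin 3) → ℝ≥0∞ := fun y =>
    ‖P y‖ₑ ^ (3 / 2 : ℝ) * ENNReal.ofReal (‖y‖ ^ (2 * ρ - 2)) with hf
  have hfm : AEMeasurable f volume :=
    (hPm.aemeasurable.enorm.pow_const _).mul ((measurable_norm.pow_const _).ennreal_ofReal.aemeasurable)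
  set lam : ℝ≥0∞ := ENNReal.ofReal (k * L ^ (1 + 2 * ρ)) with hlam
  have hlam0 : lam ≠ 0 := (ENNReal.ofReal_pos.2 (by positivity)).ne'
  have hS'le : volume S' ≤ ENNReal.ofReal CDp / lam := by
    refine (measure_le_lintegral_div hfm hlam0 ENNReal.ofReal_ne_top fun y hy => ?_).trans (ENNReal.div_le_div_right hD' _)
    obtain ⟨hy1, hy5, hyP⟩ := hy
    have hyn : 0 < ‖y‖ := by linarith
    have hPy : κ * L ^ 2 / 2 ≤ ‖P y‖ := hyP.le.trans (Real.le_norm_self _)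
    have hw : (5 * L) ^ (2 * ρ - 2) ≤ ‖y‖ ^ (2 * ρ - 2) := Real.rpow_le_rpow_of_nonpos hyn hy5.le (by linarith)
    rw [hf]; dsimp only
    rw [hlam]
    have e : k * L ^ (1 + 2 * ρ) = (κ * L ^ 2 / 2) ^ (3 / 2 : ℝ) * (5 * L) ^ (2 * ρ - 2) := by
      rw [hk, show κ * L ^ 2 / 2 = κ / 2 * L ^ 2 by ring, Real.mul_rpow (by positivity) (by positivity),
        Real.mul_rpow (by norm_num) hL0.le]
      have e3 : (L ^ 2) ^ (3 / 2 : ℝ) = L ^ (3 : ℝ) := by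
        rw [← Real.rpow_natCast L 2, ← Real.rpow_mul hL0.le]; norm_num
      rw [e3]
      have e4 : L ^ (1 + 2 * ρ) = L ^ (3 : ℝ) * L ^ (2 * ρ - 2) := by
        rw [← Real.rpow_add hL0]; ring_nf
      rw [e4]; ring
    rw [e, ENNReal.ofReal_mul (by positivity)]
    refine mul_le_mul' ?_ (ENNReal.ofReal_le_ofReal hw)
    calc ENNReal.ofReal ((κ * L ^ 2 / 2) ^ (3 / 2 : ℝ))
        = ENNReal.ofReal (κ * L ^ 2 / 2) ^ (3 / 2 : ℝ) := by
          rw [ENNReal.ofReal_rpow_of_nonneg (by positivity) (by norm_num)]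
      _ ≤ ‖P y‖ₑ ^ (3 / 2 : ℝ) := by
          refine ENNReal.rpow_le_rpow ?_ (by norm_num)
          rw [← ofReal_norm]
          exact ENNReal.ofReal_le_ofReal hPy
  calc volume S ≤ volume S' := measure_mono_ae hsub
    _ ≤ ENNReal.ofReal CDp / lam := hS'le
    _ = ENNReal.ofReal (CDp / k * L ^ (-1 - 2 * ρ)) := by
        rw [hlam, ← ENNReal.ofReal_div_of_pos (by positivity)]
        congr 1
        rw [show (-1 - 2 * ρ : ℝ) = -(1 + 2 * ρ) by ring, Real.rpow_neg hL0.le]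
        field_simp

/-! ### The bootstrap: the pressurised set is SOBOLEV-thin (GNS on a smooth truncation of `P′`) -/

/-- **A `C¹` truncation at height `A`.**  There is `D ≥ 0` such that for every `A > 0` and every `C¹` function `P′` there is a `C¹` function `g`
with `0 ≤ g ≤ A`, `g = 0` on `{P′ ≤ A}`, `g = A` on `{2A ≤ P′}` and `‖∇g‖ ≤ D‖∇P′‖` (`g = A·S((P′ − A)/A)`, `S` Mathlib's smooth transition). [folklore] -/
theorem exists_truncation :
    ∃ D : ℝ, 0 ≤ D ∧ ∀ A : ℝ, 0 < A → ∀ P' : EuclideanSpace ℝ (Fin 3) → ℝ, ContDiff ℝ 1 P' →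
      ∃ g : EuclideanSpace ℝ (Fin 3) → ℝ, ContDiff ℝ 1 g ∧ (∀ y, 0 ≤ g y) ∧ (∀ y, g y ≤ A) ∧
        (∀ y, P' y ≤ A → g y = 0) ∧ (∀ y, 2 * A ≤ P' y → g y = A) ∧ (∀ y, ‖fderiv ℝ g y‖ ≤ D * ‖fderiv ℝ P' y‖) := by
  obtain ⟨D, hD0, hD⟩ := Literature.Analysis.Calculus.exists_bound_deriv_smoothTransition
  refine ⟨D, hD0, fun A hA0 P' hP'1 => ?_⟩
  have hP'd : Differentiable ℝ P' := hP'1.differentiable one_ne_zero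
  set φ : EuclideanSpace ℝ (Fin 3) → ℝ := fun y => (P' y - A) * A⁻¹ with hφdef
  set g : EuclideanSpace ℝ (Fin 3) → ℝ := fun y => A * Real.smoothTransition (φ y) with hgdef
  have hφ1 : ContDiff ℝ 1 φ := (hP'1.sub contDiff_const).mul contDiff_const
  have hg1 : ContDiff ℝ 1 g := contDiff_const.mul (Real.smoothTransition.contDiff.comp hφ1)
  refine ⟨g, hg1, fun y => mul_nonneg hA0.le (Real.smoothTransition.nonneg _),
    fun y => mul_le_of_le_one_right hA0.le (Real.smoothTransition.le_one _), fun y hy => ?_, fun y hy => ?_, fun y => ?_⟩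
  · have hφ : φ y ≤ 0 := by
      show (P' y - A) * A⁻¹ ≤ 0
      exact mul_nonpos_of_nonpos_of_nonneg (by linarith) (inv_nonneg.2 hA0.le)
    show A * Real.smoothTransition (φ y) = 0
    rw [Real.smoothTransition.zero_of_nonpos hφ, mul_zero]
  · have hφ : 1 ≤ φ y := by
      show 1 ≤ (P' y - A) * A⁻¹
      rw [← div_eq_mul_inv, le_div_iff₀ hA0]; linarith
    show A * Real.smoothTransition (φ y) = A
    rw [Real.smoothTransition.one_of_one_le hφ, mul_one]
  · have hφ' : HasFDerivAt φ (A⁻¹ • fderiv ℝ P' y) y := ((hP'd y).hasFDerivAt.sub_const A).mul_const A⁻¹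
    have hsT : HasDerivAt Real.smoothTransition (deriv Real.smoothTransition (φ y)) (φ y) :=
      ((Real.smoothTransition.contDiff (n := 1)).differentiable (by simp) (φ y)).hasDerivAt
    have hcomp : HasFDerivAt g (A • (deriv Real.smoothTransition (φ y) • (A⁻¹ • fderiv ℝ P' y))) y :=
      (hsT.comp_hasFDerivAt y hφ').const_mul A
    rw [hcomp.fderiv, norm_smul, norm_smul, norm_smul, Real.norm_of_nonneg hA0.le,
      Real.norm_of_nonneg (inv_nonneg.2 hA0.le), Real.norm_eq_abs]
    have hAi : A * A⁻¹ = 1 := mul_inv_cancel₀ hA0.ne'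
    calc A * (|deriv Real.smoothTransition (φ y)| * (A⁻¹ * ‖fderiv ℝ P' y‖))
        = (A * A⁻¹) * (|deriv Real.smoothTransition (φ y)| * ‖fderiv ℝ P' y‖) := by ring
      _ ≤ D * ‖fderiv ℝ P' y‖ := by
          rw [hAi, one_mul]
          exact mul_le_mul_of_nonneg_right (hD _) (norm_nonneg _)

/-- **Pointwise gradient bound for the truncation on `B_{5L}`**: with `‖∇g‖ ≤ D‖∇P′‖`, the profile equation and `‖V y‖ ≤ K₁(1+‖y‖)`,
`‖∇g(y)‖² ≤ 2D²(1−γ)²‖V y‖² + 2D²(γ+K₁)²(1+5L)²‖∇V(y)‖²` for `‖y‖ < 5L` (extended-real form). [folklore] -/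
theorem enorm_fderiv_truncation_sq_le {γ : ℝ} (hγ0 : 0 ≤ γ) (hγ1 : γ ≤ 1)
    {V : EuclideanSpace ℝ (Fin 3) → EuclideanSpace ℝ (Fin 3)} {P' : EuclideanSpace ℝ (Fin 3) → ℝ}
    (hprof : IsSelfSimilarEulerProfile γ 0 V P') {K₁ : ℝ} (hK₁0 : 0 ≤ K₁) (hK₁ : ∀ y : EuclideanSpace ℝ (Fin 3), ‖V y‖ ≤ K₁ * (1 + ‖y‖))
    {g : EuclideanSpace ℝ (Fin 3) → ℝ} {D : ℝ} (hD0 : 0 ≤ D) (hdg : ∀ y, ‖fderiv ℝ g y‖ ≤ D * ‖fderiv ℝ P' y‖)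
    {L : ℝ} (hL : 0 < L) {y : EuclideanSpace ℝ (Fin 3)} (hy : ‖y‖ < 5 * L) :
    ‖fderiv ℝ g y‖ₑ ^ 2 ≤ ENNReal.ofReal (2 * D ^ 2 * (1 - γ) ^ 2) * ‖V y‖ₑ ^ 2 +
      ENNReal.ofReal (2 * D ^ 2 * (γ + K₁) ^ 2 * (1 + 5 * L) ^ 2) * ‖fderiv ℝ V y‖ₑ ^ 2 := by
  have hP := norm_fderiv_pressure_le_of_profile hγ0 hγ1 hprof y
  set a : ℝ := (1 - γ) * ‖V y‖ with ha
  set b : ℝ := (γ + K₁) * (1 + 5 * L) * ‖fderiv ℝ V y‖ with hb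
  have hVy : ‖V y‖ ≤ K₁ * (1 + 5 * L) := (hK₁ y).trans (by nlinarith)
  have hco : γ * ‖y‖ + ‖V y‖ ≤ (γ + K₁) * (1 + 5 * L) := by nlinarith [norm_nonneg y]
  have h2 : ‖fderiv ℝ P' y‖ ≤ a + b := by
    refine hP.trans (add_le_add le_rfl ?_)
    rw [hb, mul_comm ((γ + K₁) * (1 + 5 * L))]
    exact mul_le_mul_of_nonneg_left hco (norm_nonneg _)
  have h4 : ‖fderiv ℝ g y‖ ≤ D * (a + b) := (hdg y).trans (mul_le_mul_of_nonneg_left h2 hD0)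
  have ha0 : 0 ≤ a := by rw [ha]; exact mul_nonneg (by linarith) (norm_nonneg _)
  have hb0 : 0 ≤ b := by rw [hb]; positivity
  have hab : (a + b) ^ 2 ≤ 2 * a ^ 2 + 2 * b ^ 2 := by nlinarith [sq_nonneg (a - b)]
  have h3 : ‖fderiv ℝ g y‖ ^ 2 ≤ 2 * D ^ 2 * (1 - γ) ^ 2 * ‖V y‖ ^ 2 + 2 * D ^ 2 * (γ + K₁) ^ 2 * (1 + 5 * L) ^ 2 * ‖fderiv ℝ V y‖ ^ 2 := by
    have h5 : ‖fderiv ℝ g y‖ ^ 2 ≤ (D * (a + b)) ^ 2 := pow_le_pow_left₀ (norm_nonneg _) h4 2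
    have h6 : (D * (a + b)) ^ 2 ≤ D ^ 2 * (2 * a ^ 2 + 2 * b ^ 2) := by
      rw [mul_pow]; exact mul_le_mul_of_nonneg_left hab (sq_nonneg D)
    have h7 : D ^ 2 * (2 * a ^ 2 + 2 * b ^ 2) =
        2 * D ^ 2 * (1 - γ) ^ 2 * ‖V y‖ ^ 2 + 2 * D ^ 2 * (γ + K₁) ^ 2 * (1 + 5 * L) ^ 2 * ‖fderiv ℝ V y‖ ^ 2 := by
      rw [ha, hb]; ring
    linarith [h5, h6, h7.le]
  have e1 : ‖fderiv ℝ g y‖ₑ ^ 2 = ENNReal.ofReal (‖fderiv ℝ g y‖ ^ 2) := by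
    rw [← ofReal_norm, ENNReal.ofReal_pow (norm_nonneg _)]
  have e2 : ‖fderiv ℝ V y‖ₑ ^ 2 = ENNReal.ofReal (‖fderiv ℝ V y‖ ^ 2) := by
    rw [← ofReal_norm, ENNReal.ofReal_pow (norm_nonneg _)]
  have e3 : ‖V y‖ₑ ^ 2 = ENNReal.ofReal (‖V y‖ ^ 2) := by
    rw [← ofReal_norm, ENNReal.ofReal_pow (norm_nonneg _)]
  rw [e1, e2, e3, ← ENNReal.ofReal_mul (by positivity), ← ENNReal.ofReal_mul (by positivity),
    ← ENNReal.ofReal_add (by positivity) (by positivity)]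
  exact ENNReal.ofReal_le_ofReal h3

/-- Real bookkeeping for the bootstrap: the three `L`-dependent terms are `≤ const · L^{3−ρ}` for `L ≥ 1`, `ρ ≥ −2`. [folklore] -/
theorem bootstrap_bookkeeping {ρ L D γ K₁ cA cE M κ CP : ℝ} (hρ : -2 ≤ ρ) (hL : 1 ≤ L) (hcA : 0 ≤ cA) (hcE : 0 ≤ cE) (hCP : 0 ≤ CP) :
    2 * (2 * D ^ 2 * (1 - γ) ^ 2 * (cA * (5 * L) ^ (1 - 2 * ρ)) +
          2 * D ^ 2 * (γ + K₁) ^ 2 * (1 + 5 * L) ^ 2 * (cE * (5 * L) ^ (1 - ρ))) +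
        2 * (M / L) ^ 2 * ((κ * L ^ 2) ^ 2 * (CP * L ^ (-1 - 2 * ρ))) ≤
      (2 * (2 * D ^ 2 * (1 - γ) ^ 2 * (cA * 5 ^ (1 - 2 * ρ)) + 2 * D ^ 2 * (γ + K₁) ^ 2 * 36 * (cE * 5 ^ (1 - ρ))) +
          2 * (M ^ 2 * κ ^ 2 * CP)) * L ^ (3 - ρ) := by
  have hL0 : 0 < L := one_pos.trans_le hL
  have hmono1 : L ^ (1 - 2 * ρ) ≤ L ^ (3 - ρ) := Real.rpow_le_rpow_of_exponent_le hL (by linarith)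
  have e5a : (5 * L) ^ (1 - 2 * ρ) = 5 ^ (1 - 2 * ρ) * L ^ (1 - 2 * ρ) := Real.mul_rpow (by norm_num) hL0.le
  have e5b : (5 * L) ^ (1 - ρ) = 5 ^ (1 - ρ) * L ^ (1 - ρ) := Real.mul_rpow (by norm_num) hL0.le
  have eL2 : L ^ 2 * L ^ (1 - ρ) = L ^ (3 - ρ) := by
    rw [← Real.rpow_natCast L 2, ← Real.rpow_add hL0]; norm_num; ring_nf
  -- term 1
  have t1 : 2 * D ^ 2 * (1 - γ) ^ 2 * (cA * (5 * L) ^ (1 - 2 * ρ)) ≤ 2 * D ^ 2 * (1 - γ) ^ 2 * (cA * 5 ^ (1 - 2 * ρ)) * L ^ (3 - ρ) := by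
    rw [e5a]
    have h0 : 0 ≤ 2 * D ^ 2 * (1 - γ) ^ 2 * (cA * 5 ^ (1 - 2 * ρ)) := by positivity
    calc 2 * D ^ 2 * (1 - γ) ^ 2 * (cA * (5 ^ (1 - 2 * ρ) * L ^ (1 - 2 * ρ)))
        = 2 * D ^ 2 * (1 - γ) ^ 2 * (cA * 5 ^ (1 - 2 * ρ)) * L ^ (1 - 2 * ρ) := by ring
      _ ≤ 2 * D ^ 2 * (1 - γ) ^ 2 * (cA * 5 ^ (1 - 2 * ρ)) * L ^ (3 - ρ) := mul_le_mul_of_nonneg_left hmono1 h0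
  -- term 2
  have t2 : 2 * D ^ 2 * (γ + K₁) ^ 2 * (1 + 5 * L) ^ 2 * (cE * (5 * L) ^ (1 - ρ)) ≤
      2 * D ^ 2 * (γ + K₁) ^ 2 * 36 * (cE * 5 ^ (1 - ρ)) * L ^ (3 - ρ) := by
    rw [e5b]
    have h36 : (1 + 5 * L) ^ 2 ≤ 36 * L ^ 2 := by nlinarith
    have hP1 : 0 < L ^ (1 - ρ) := Real.rpow_pos_of_pos hL0 _
    calc 2 * D ^ 2 * (γ + K₁) ^ 2 * (1 + 5 * L) ^ 2 * (cE * (5 ^ (1 - ρ) * L ^ (1 - ρ)))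
        ≤ 2 * D ^ 2 * (γ + K₁) ^ 2 * (36 * L ^ 2) * (cE * (5 ^ (1 - ρ) * L ^ (1 - ρ))) := by gcongr
      _ = 2 * D ^ 2 * (γ + K₁) ^ 2 * 36 * (cE * 5 ^ (1 - ρ)) * (L ^ 2 * L ^ (1 - ρ)) := by ring
      _ = 2 * D ^ 2 * (γ + K₁) ^ 2 * 36 * (cE * 5 ^ (1 - ρ)) * L ^ (3 - ρ) := by rw [eL2]
  -- term 3
  have t3 : (M / L) ^ 2 * ((κ * L ^ 2) ^ 2 * (CP * L ^ (-1 - 2 * ρ))) ≤ M ^ 2 * κ ^ 2 * CP * L ^ (3 - ρ) := by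
    have e7 : L ^ 2 * L ^ (-1 - 2 * ρ) = L ^ (1 - 2 * ρ) := by
      rw [← Real.rpow_natCast L 2, ← Real.rpow_add hL0]; norm_num; ring_nf
    have e : (M / L) ^ 2 * ((κ * L ^ 2) ^ 2 * (CP * L ^ (-1 - 2 * ρ))) = M ^ 2 * κ ^ 2 * CP * L ^ (1 - 2 * ρ) := by
      rw [← e7, div_pow]
      have hL2 : (L ^ 2 : ℝ) ≠ 0 := by positivity
      field_simp
    rw [e]
    exact mul_le_mul_of_nonneg_left hmono1 (by positivity)
  nlinarith [t1, t2, t3]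

/-- Real bookkeeping: `Cr⁶ (Z L^{3−ρ})³ / (κL²)⁶ = (Cr⁶ Z³ / κ⁶) L^{−3−3ρ}` for `L > 0`, `κ > 0`. [folklore] -/
theorem bootstrap_exponent {Cr Z κ L ρ : ℝ} (hL : 0 < L) (hκ : 0 < κ) :
    Cr ^ 6 * (Z * L ^ (3 - ρ)) ^ 3 / (κ * L ^ 2) ^ 6 = Cr ^ 6 * Z ^ 3 / κ ^ 6 * L ^ (-3 - 3 * ρ) := by
  have e1 : (Z * L ^ (3 - ρ)) ^ 3 = Z ^ 3 * L ^ (9 - 3 * ρ) := by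
    rw [mul_pow]
    congr 1
    rw [← Real.rpow_natCast (L ^ (3 - ρ)) 3, ← Real.rpow_mul hL.le]
    push_cast
    ring_nf
  have e2 : (κ * L ^ 2) ^ 6 = κ ^ 6 * L ^ (12 : ℝ) := by
    rw [mul_pow]
    congr 1
    rw [← Real.rpow_natCast (L ^ 2) 6, ← Real.rpow_natCast L 2, ← Real.rpow_mul hL.le]
    norm_num
  have e3 : L ^ (-3 - 3 * ρ) = L ^ (9 - 3 * ρ) / L ^ (12 : ℝ) := by
    rw [← Real.rpow_sub hL]; ring_nf
  rw [e1, e2, e3]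
  have hκ6 : κ ^ 6 ≠ 0 := by positivity
  have hL12 : L ^ (12 : ℝ) ≠ 0 := (Real.rpow_pos_of_pos hL _).ne'
  rw [div_mul_div_comm, mul_assoc]

end Summit.NavierStokesRegularity.NavierStokesRegularity.Theorems.PowerGaugeEulerLiouville.Loc

end
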